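import Summits.QuantumFields.QCD.Theorems.NestedDissectionSeaEarlyCrosserLawReduction
import Summits.QuantumFields.QCD.Theorems.SpectralDefectExtinctionPositivityDeficitLeDefectsRootCount
import Literature.MathematicalPhysics.QuantumFieldTheory.SpectralDefectDensity

/-!
# Early real crossers of a Dirichlet Wilson cell, COUNTED: the mean-count form behind the
# two-circle Jensen excess (line `accretive-coarse-jensen`, crux `EarlyCrosserLaw`, stmt-QuantumFields-13995)

Lead continuation `c1` of line `accretive-coarse-jensen` (2026-08-16).  The line's physics stub
`stub_jensenDilution` bounds the phase-quenched mean of a grid-summed two-circle Jensen excess of the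
massless Dirichlet cell matrices `M_Y(U) = wilsonCell U 0 x s` (window box and its sixteen children).
This file isolates the COUNT it controls, in the tree's vocabulary
(`Literature.MathematicalPhysics.QuantumFieldTheory.realSpecCount`): an EARLY CROSSER of the cell `Y`
for flavour `f` at step `k` is a real eigenvalue `u ≤ -m_f(k)` of `M_Y(U)` (equivalently the cell is
singular at the bare mass `μ' = -u ≥ m_f(k)`), counted with algebraic multiplicity by
`realSpecCount (M_Y U) (-m_f(k))`.  Deterministic facts proved here (no physics):

* `meanCount_det_eq_zero_iff_eval_charpoly` — `det (wilsonCell U μ' x s) = 0 ↔ charpoly (M_Y U) (-μ') = 0`;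
  `meanCount_one_le_realSpecCount` — a cover event of clause (a′) (cell singular at some `μ' ≥ m_f(k)`)
  forces `1 ≤ realSpecCount (M_Y U) (-m_f(k))`;
* `meanCount_re_nonneg_of_mem_roots` — real eigenvalues of `M_Y(U)` are `≥ 0` (landed positivity
  domain `wilsonCell_det_ne_zero_of_pos`), so the early crossers are exactly the real roots in the
  segment `[0, -m_f(k)]` (`meanCount_realSpecCount_eq_countP_seg`);
* `meanCount_measurable_realSpecCount` — `U ↦ realSpecCount (M_Y U) t` is Borel measurable (closed
  superlevel sets: upper semicontinuity of root counts in closed sets, the sibling route's landed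
  `PositivityDeficitLeDefects.isClosed_le_countP_charpoly_roots`, composed with the continuity of
  `U ↦ wilsonCell U 0 x s`), so its Bochner integrals against the Wilson measure are honest;
* `meanCount_log_two_mul_realSpecCount_le_gridSum` — for EVERY radius `r > 0` the grid-summed
  two-circle excess of the line (centres `(2n+1) r`, `n ≤ ⌊T/2r⌋`, radii `r < 2r`) is
  `≥ log 2 · realSpecCount (M_Y U) T`: every real root `u ∈ [0, T]` lies within `r` of the centre of
  its own grid disc and is charged `log 2` there (`crossingCharge_kernel_eq`), all other terms are
  `≥ 0` (`crossingCharge_kernel_nonneg`).  (Polynomial form adapted from the drefute seat's candidate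
  `log_two_mul_card_real_roots_le_gridSum`, `Cruxes/EarlyCrosserLaw/StubsOneTwo_CandidateProofs.lean`.)

Consequence (companion file `…MeanCountReduction.lean`): at fixed data the Jensen law IMPLIES the
mean-count law `E₊[#early crossers of the window cell and its children] ≤ δ_j`, which in turn implies
clause (a′) by Markov — so the line's physics debt is exactly "two-sided pin + mean-count law", with the
Jensen excess as one sufficient analytic handle on the count.
-/

noncomputable section

open scoped BigOperators Matrix ComplexConjugate
open Filter MeasureTheory Polynomial
open Literature.MathematicalPhysics.QuantumLattice Literature.MathematicalPhysics.QuantumFieldTheory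
  Literature.Probability.LatticeModels
open Summit.QuantumFields.QCD.Theses.NestedDissectionSea

namespace Summit.QuantumFields.QCD.Cruxes.EarlyCrosserLaw.AccretiveCoarseJensen

open scoped Classical

/-! ### § 1  Singular cells are real eigenvalues of the massless cell matrix -/

/-- The cell at bare mass `μ'` is singular iff `-μ'` is a root of the characteristic polynomial of the
massless cell matrix (`D_c(μ') = D_c(0) + μ' • 1`). -/
theorem meanCount_det_eq_zero_iff_eval_charpoly {N : ℕ} [NeZero N] (U : GaugeConfig 4 N SU3)
    (μ' : ℝ) (x : TorusSite 4 N) (s : Fin 4 → ℕ) :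
    (wilsonCell U μ' x s).det = 0 ↔
      ((wilsonCell U 0 x s).charpoly).eval (-((μ' : ℝ) : ℂ)) = 0 := by
  rw [Matrix.eval_charpoly]
  have key : Matrix.scalar _ (-((μ' : ℝ) : ℂ)) - wilsonCell U 0 x s = -wilsonCell U μ' x s := by
    rw [crossingCharge_wilsonCell_eq_add_smul_one U μ' x s]
    ext i j
    simp only [Matrix.scalar_apply, Matrix.sub_apply, Matrix.diagonal_apply, Matrix.neg_apply,
      Matrix.add_apply, Matrix.smul_apply, Matrix.one_apply, smul_eq_mul]
    split_ifs <;> ring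
  rw [key, Matrix.det_neg, mul_eq_zero, or_iff_right]
  exact pow_ne_zero _ (neg_ne_zero.2 one_ne_zero)

/-- **A cover event is an early real crosser, counted.**  If the cell `(x, s)` is singular at a bare
mass `μ' ≥ t`, then its massless cell matrix has a real eigenvalue `-μ' ≤ -t`:
`1 ≤ realSpecCount (wilsonCell U 0 x s) (-t)`. -/
theorem meanCount_one_le_realSpecCount {N : ℕ} [NeZero N] (U : GaugeConfig 4 N SU3) (x : TorusSite 4 N)
    (s : Fin 4 → ℕ) {t μ' : ℝ} (ht : t ≤ μ') (hdet : (wilsonCell U μ' x s).det = 0) :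
    1 ≤ realSpecCount (wilsonCell U 0 x s) (-t) := by
  rw [← countP_roots_eq_realSpecCount (wilsonCell U 0 x s) (-t), Nat.succ_le_iff, Multiset.countP_pos]
  refine ⟨-((μ' : ℝ) : ℂ), ?_, ?_, ?_⟩
  · rw [Polynomial.mem_roots (Matrix.charpoly_monic _).ne_zero, Polynomial.IsRoot.def]
    exact (meanCount_det_eq_zero_iff_eval_charpoly U μ' x s).1 hdet
  · simp
  · simp only [Complex.neg_re, Complex.ofReal_re]
    linarith

/-- **Real eigenvalues of the massless Dirichlet cell matrix are non-negative**: a real root `u < 0`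
would make the cell singular at the positive bare mass `-u`, excluded by the landed positivity domain
`wilsonCell_det_ne_zero_of_pos`. -/
theorem meanCount_re_nonneg_of_mem_roots {N : ℕ} [NeZero N] (U : GaugeConfig 4 N SU3) (x : TorusSite 4 N)
    (s : Fin 4 → ℕ) {u : ℂ} (hu : u ∈ (wilsonCell U 0 x s).charpoly.roots) (him : u.im = 0) :
    0 ≤ u.re := by
  by_contra hneg
  have hlt : 0 < -u.re := by linarith [lt_of_not_ge hneg]
  have hu' : -(((-u.re : ℝ)) : ℂ) = u := by
    apply Complex.ext <;> simp [him]
  have hroot : ((wilsonCell U 0 x s).charpoly).eval (-(((-u.re : ℝ)) : ℂ)) = 0 := by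
    rw [hu']
    exact (Polynomial.mem_roots (Matrix.charpoly_monic _).ne_zero).1 hu
  exact Summit.QuantumFields.QCD.Theorems.EarlyCrosserLawNegative.wilsonCell_det_ne_zero_of_pos U hlt x s
    ((meanCount_det_eq_zero_iff_eval_charpoly U (-u.re) x s).2 hroot)

/-- The early crossers are exactly the real roots in the SEGMENT `[0, T]`:
`realSpecCount (wilsonCell U 0 x s) T = #{roots u : Im u = 0, 0 ≤ Re u ≤ T}` (with multiplicity). -/
theorem meanCount_realSpecCount_eq_countP_seg {N : ℕ} [NeZero N] (U : GaugeConfig 4 N SU3)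
    (x : TorusSite 4 N) (s : Fin 4 → ℕ) (T : ℝ) :
    realSpecCount (wilsonCell U 0 x s) T =
      (wilsonCell U 0 x s).charpoly.roots.countP (fun u => u.im = 0 ∧ 0 ≤ u.re ∧ u.re ≤ T) := by
  rw [← countP_roots_eq_realSpecCount (wilsonCell U 0 x s) T, Multiset.countP_eq_card_filter,
    Multiset.countP_eq_card_filter]
  congr 1
  exact Multiset.filter_congr fun u hu =>
    ⟨fun h => ⟨h.1, meanCount_re_nonneg_of_mem_roots U x s hu h.1, h.2⟩, fun h => ⟨h.1, h.2.2⟩⟩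

/-! ### § 2  Measurability of the count in the gauge field -/

/-- The Dirichlet cell matrix depends continuously on the gauge field (its entries are entries of
`wilsonDirac`, affine in the links). -/
theorem meanCount_continuous_wilsonCell {N : ℕ} [NeZero N] (x : TorusSite 4 N) (s : Fin 4 → ℕ) (μ : ℝ) :
    Continuous fun U : GaugeConfig 4 N SU3 => wilsonCell U μ x s := by
  refine continuous_matrix fun i j => ?_
  simp only [wilsonCell, Matrix.toSquareBlockProp_def, Matrix.of_apply]
  exact (continuous_wilsonDirac (fundamentalRep (Fin 3)) (continuous_fundamentalRep (Fin 3)) μ 1).matrix_elem _ _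

/-- **Closed superlevel sets of the early-crosser count** (upper semicontinuity in the gauge field):
`{U | q ≤ realSpecCount (wilsonCell U 0 x s) t}` is closed — the sibling route's landed root-count
semicontinuity `PositivityDeficitLeDefects.isClosed_le_countP_charpoly_roots` for the closed half-line
`{Im = 0, Re ≤ t}` along the continuous family `U ↦ wilsonCell U 0 x s`. -/
theorem meanCount_isClosed_le_realSpecCount {N : ℕ} [NeZero N] (x : TorusSite 4 N) (s : Fin 4 → ℕ)
    (t : ℝ) (q : ℕ) :
    IsClosed {U : GaugeConfig 4 N SU3 | q ≤ realSpecCount (wilsonCell U 0 x s) t} := by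
  have hF : IsClosed {w : ℂ | w.im = 0 ∧ w.re ≤ t} :=
    (isClosed_eq Complex.continuous_im continuous_const).inter
      (isClosed_le Complex.continuous_re continuous_const)
  have h := Summit.QuantumFields.QCD.Theorems.PositivityDeficitLeDefects.isClosed_le_countP_charpoly_roots
    (meanCount_continuous_wilsonCell (N := N) x s 0) hF q
  have hset : {U : GaugeConfig 4 N SU3 | q ≤ realSpecCount (wilsonCell U 0 x s) t} =
      {U : GaugeConfig 4 N SU3 | q ≤ (wilsonCell U 0 x s).charpoly.roots.countP
        (· ∈ {w : ℂ | w.im = 0 ∧ w.re ≤ t})} := by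
    ext U
    simp only [Set.mem_setOf_eq]
    rw [← countP_roots_eq_realSpecCount (wilsonCell U 0 x s) t]
  rw [hset]
  exact h

/-- **Measurability of the early-crosser count**: `U ↦ realSpecCount (wilsonCell U 0 x s) t` is Borel
measurable on the gauge-field configuration space (all superlevel sets are closed). -/
theorem meanCount_measurable_realSpecCount {N : ℕ} [NeZero N] (x : TorusSite 4 N) (s : Fin 4 → ℕ)
    (t : ℝ) : Measurable fun U : GaugeConfig 4 N SU3 => realSpecCount (wilsonCell U 0 x s) t :=
  Summit.QuantumFields.QCD.Theorems.PositivityDeficitLeDefects.measurable_of_measurableSet_le fun q =>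
    (meanCount_isClosed_le_realSpecCount x s t q).measurableSet

/-- The count, cast to `ℝ`, is measurable, non-negative and bounded by the cell size. -/
theorem meanCount_measurable_realSpecCount_real {N : ℕ} [NeZero N] (x : TorusSite 4 N) (s : Fin 4 → ℕ)
    (t : ℝ) : Measurable fun U : GaugeConfig 4 N SU3 => (realSpecCount (wilsonCell U 0 x s) t : ℝ) :=
  measurable_from_top.comp (meanCount_measurable_realSpecCount x s t)

/-! ### § 3  The grid-summed two-circle excess dominates `log 2 ·` the count, for every radius -/

/-- Sum of an indicator over a multiset: `Σ (if P u then a else 0) = a · #{u | P u}`. -/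
theorem meanCount_sum_map_ite {α : Type*} (m : Multiset α) (P : α → Prop) [DecidablePred P] (a : ℝ) :
    (m.map fun u => if P u then a else 0).sum = a * (m.countP P : ℝ) := by
  rw [Multiset.countP_eq_card_filter]
  induction m using Multiset.induction_on with
  | empty => simp
  | cons u m ih =>
    rw [Multiset.map_cons, Multiset.sum_cons, ih, Multiset.filter_cons]
    split_ifs with h
    · simp only [Multiset.singleton_add, Multiset.card_cons]
      push_cast
      ring
    · simp

/-- **Grid charge of the real roots in a segment (polynomial level).**  For a monic complex polynomial
`p`, every radius `r > 0` and threshold `T`: the two-circle Jensen excesses (radii `r < 2r`) about the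
grid centres `(2n+1) r`, `n ≤ ⌊T/2r⌋`, sum to at least `log 2 · #{roots u : Im u = 0, 0 ≤ Re u ≤ T}`:
in root form (`excessRegular_excess_eq_sum`) every root is charged `≥ 0` by every disc
(`crossingCharge_kernel_nonneg`), and a real root `u ∈ [0, T]` lies within `r` of the centre of the
disc `n = ⌊u/2r⌋`, which charges it `log (2r/r) = log 2` (`crossingCharge_kernel_eq`).  (Adapted from the
drefute seat's candidate `log_two_mul_card_real_roots_le_gridSum`.) -/
theorem meanCount_log_two_mul_countP_le_gridSum (p : ℂ[X]) (hp : p.Monic) (T : ℝ) {r : ℝ} (hr : 0 < r) :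
    Real.log 2 * (p.roots.countP (fun u => u.im = 0 ∧ 0 ≤ u.re ∧ u.re ≤ T) : ℝ) ≤
      ∑ n ∈ Finset.range (⌊T / (2 * r)⌋₊ + 1),
        (Real.circleAverage (fun z => Real.log ‖p.eval z‖) (((2 * (n : ℝ) + 1) * r : ℝ) : ℂ) (2 * r)
          - Real.circleAverage (fun z => Real.log ‖p.eval z‖) (((2 * (n : ℝ) + 1) * r : ℝ) : ℂ) r) := by
  have hr2 : 0 < 2 * r := by linarith
  have hrr : r < 2 * r := by linarith
  have hlog2 : Real.log (2 * r / r) = Real.log 2 := by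
    rw [mul_div_assoc, div_self hr.ne', mul_one]
  -- root form of every disc, then swap the sums
  have hdisc : ∀ n : ℕ,
      Real.circleAverage (fun z => Real.log ‖p.eval z‖) (((2 * (n : ℝ) + 1) * r : ℝ) : ℂ) (2 * r)
        - Real.circleAverage (fun z => Real.log ‖p.eval z‖) (((2 * (n : ℝ) + 1) * r : ℝ) : ℂ) r =
      (p.roots.map fun u =>
        (Real.log (2 * r) + Real.posLog ((2 * r)⁻¹ * ‖(((2 * (n : ℝ) + 1) * r : ℝ) : ℂ) - u‖))
          - (Real.log r + Real.posLog (r⁻¹ * ‖(((2 * (n : ℝ) + 1) * r : ℝ) : ℂ) - u‖))).sum :=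
    fun n => excessRegular_excess_eq_sum hp _ hr hrr
  simp_rw [hdisc]
  rw [Finset.sum_eq_multiset_sum, Multiset.sum_map_sum_map]
  simp_rw [← Finset.sum_eq_multiset_sum]
  -- compare root by root
  have key : ∀ u ∈ p.roots,
      (if (u.im = 0 ∧ 0 ≤ u.re ∧ u.re ≤ T) then Real.log 2 else 0) ≤
        ∑ n ∈ Finset.range (⌊T / (2 * r)⌋₊ + 1),
          ((Real.log (2 * r) + Real.posLog ((2 * r)⁻¹ * ‖(((2 * (n : ℝ) + 1) * r : ℝ) : ℂ) - u‖))
            - (Real.log r + Real.posLog (r⁻¹ * ‖(((2 * (n : ℝ) + 1) * r : ℝ) : ℂ) - u‖))) := by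
    intro u _
    have hnn : ∀ n ∈ Finset.range (⌊T / (2 * r)⌋₊ + 1),
        0 ≤ (Real.log (2 * r) + Real.posLog ((2 * r)⁻¹ * ‖(((2 * (n : ℝ) + 1) * r : ℝ) : ℂ) - u‖))
          - (Real.log r + Real.posLog (r⁻¹ * ‖(((2 * (n : ℝ) + 1) * r : ℝ) : ℂ) - u‖)) :=
      fun n _ => crossingCharge_kernel_nonneg hr hrr (norm_nonneg _)
    split_ifs with hu
    · obtain ⟨him, h0, hT'⟩ := hu
      set t : ℝ := u.re with ht
      set n : ℕ := ⌊t / (2 * r)⌋₊ with hn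
      have hn_mem : n ∈ Finset.range (⌊T / (2 * r)⌋₊ + 1) := by
        rw [Finset.mem_range, Nat.lt_add_one_iff]
        exact Nat.floor_mono (div_le_div_of_nonneg_right hT' hr2.le)
      have hn_le : (n : ℝ) ≤ t / (2 * r) := Nat.floor_le (div_nonneg h0 hr2.le)
      have hn_lt : t / (2 * r) < n + 1 := Nat.lt_floor_add_one _
      have hcentre : ‖(((2 * (n : ℝ) + 1) * r : ℝ) : ℂ) - u‖ ≤ r := by
        have hu' : u = ((t : ℝ) : ℂ) := Complex.ext (by simp [ht]) (by simp [him])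
        rw [hu', ← Complex.ofReal_sub, Complex.norm_real, Real.norm_eq_abs, abs_le]
        have h1 : (n : ℝ) * (2 * r) ≤ t := (le_div_iff₀ hr2).mp hn_le
        have h2 : t < ((n : ℝ) + 1) * (2 * r) := (div_lt_iff₀ hr2).mp hn_lt
        constructor <;> nlinarith
      refine le_trans ?_ (Finset.single_le_sum hnn hn_mem)
      rw [crossingCharge_kernel_eq hr hrr (norm_nonneg _) hcentre, hlog2]
    · exact Finset.sum_nonneg hnn
  calc Real.log 2 * (p.roots.countP (fun u => u.im = 0 ∧ 0 ≤ u.re ∧ u.re ≤ T) : ℝ)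
      = (p.roots.map fun u => if (u.im = 0 ∧ 0 ≤ u.re ∧ u.re ≤ T) then Real.log 2 else 0).sum := by
        rw [meanCount_sum_map_ite]
    _ ≤ _ := Multiset.sum_map_le_sum_map _ _ key

/-- **Grid charge of the early crossers of a cell.**  For every gauge field, cell `(x, s)`, threshold `T`
and radius `r > 0`: `log 2 · realSpecCount (wilsonCell U 0 x s) T` is at most the grid-summed two-circle
Jensen excess of `log ‖charpoly (wilsonCell U 0 x s)‖` (centres `(2n+1) r`, `n ≤ ⌊T/2r⌋`, radii
`r < 2r`) — the deterministic comparison "Jensen statistic ≥ log 2 · count" at FIXED radius. -/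
theorem meanCount_log_two_mul_realSpecCount_le_gridSum {N : ℕ} [NeZero N] (U : GaugeConfig 4 N SU3)
    (x : TorusSite 4 N) (s : Fin 4 → ℕ) (T : ℝ) {r : ℝ} (hr : 0 < r) :
    Real.log 2 * (realSpecCount (wilsonCell U 0 x s) T : ℝ) ≤
      ∑ n ∈ Finset.range (⌊T / (2 * r)⌋₊ + 1),
        (Real.circleAverage (fun z : ℂ => Real.log ‖((wilsonCell U 0 x s).charpoly).eval z‖)
            (((2 * (n : ℝ) + 1) * r : ℝ) : ℂ) (2 * r)
          - Real.circleAverage (fun z : ℂ => Real.log ‖((wilsonCell U 0 x s).charpoly).eval z‖)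
            (((2 * (n : ℝ) + 1) * r : ℝ) : ℂ) r) := by
  rw [meanCount_realSpecCount_eq_countP_seg]
  exact meanCount_log_two_mul_countP_le_gridSum _ (Matrix.charpoly_monic _) T hr

end Summit.QuantumFields.QCD.Cruxes.EarlyCrosserLaw.AccretiveCoarseJensen

end
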